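import Literature.Analysis.FluidPDE.NSWave0
import Literature.Analysis.FluidPDE.ClassicalSolution
import Literature.Analysis.FluidPDE.LerayHopf
import Literature.Analysis.FluidPDE.LerayHopfEventualRegularity
import Literature.Claims.NS.ClayVariants
import HarnessLib

/-!
# Claim skeleton (D-0090 NS-CLAIMS, C57, T3 QUICK tranche): Vukovic 2015 — «existence and smoothness of Navier-Stokes solutions on R³»

Typed skeleton (ns-claims-typist-7 g2; RULINGS v1.29l (4), QUICK statement grain) of Ognjen Vukovic,
*Existence and Smoothness of Solution of Navier-Stokes Equation on R³*, International Journal of Modern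
Nonlinear Theory and Application **4** (2015) no. 2, 117–126, doi:10.4236/ijmnta.2015.42008 (SCIRP) =
bib `Vukovic2015NSR3`, the only version (sources `pub/ns-claims/sources/Vukovic2015/`, PDF via
web.archive.org, 10 pp.; PRINT page = PDF page + 116; per-page text `text/p001–p010.txt`; LOCATORS stub
by ns-claims-lit-1). UNREFEREED-GRADE CLAIM under adjudication — NOTHING in this file asserts a step of
the paper: its statements are `def … : Prop`; the `theorem`s are kernel-checked relations between them
(composition, Clay link, two LOGIC records). Card `pub/ns-claims/claims/Vukovic2015/CARD.md` (PREDICTION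
§4 frozen 2026-08-27T01:30Z, sha16 aaee25ba9be21727).

## The claimed statement (print p.118, verbatim)

«The statement that will be proved is existence and smoothness of Navier-Stokes solutions on R³. Take
v > 0 and n = 3. Let u₀(x) be any smooth, divergence-free vector field satisfying (1.4) [= (4), Fefferman's
decay condition]. Take f(x,t) to be identically zero. Then there exist smooth functions p(x,t), uᵢ(x,t)
on R³ x [0,∞] and the above conditions and equations are satisfied» — the conditions being the paper's
(1)–(3) (Navier–Stokes, divergence-free, datum), (6) `p, u ∈ C^∞(ℝⁿ × [0,∞))` and (7) bounded energy,
copied from Fefferman (p.117–118). This is Fefferman's (A) word for word: `ClaimedTheorem` is typed with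
(A)'s body and `claimedTheorem_iff_clayA : ClaimedTheorem ↔ ClayVariants.clayR3.Regularity` is `Iff.rfl`.
Abstract p.117: «This paper proposes a solution … on R³ … it proves the existence and uniqueness of smooth
solution»; Conclusion p.126: «This paper proves the existence of Navier-Stokes solution in R³».

## Clay delta (CARD §3): NONE — Δ1 ℝ³ = · Δ2 = · Δ3 f ≡ 0 = · Δ4 (4) = · Δ5 (6)+(7) = · Δ6 = · Δ7 = («Take v > 0»).
Uniqueness (abstract) is extra and not typed.

## Architecture as printed (§2 «Results» pp.118–123, §3 «Theoretical Findings» pp.123–126) and the typed steps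

The text assembles: Def. 1 (turbulent = Leray–Hopf weak solutions with the strong energy inequality
(11)–(13), after Oliver–Titi [1]) and Theorems 1–2 ((14), (22): Okabe's [2] asymptotic energy
concentration); the sentence p.120 «Takahiro Okabe … proves that turbulent solutions of Navier-Stokes
equation become strong solutions after some definite time. So for the turbulent solution u(t) … there
exists T* > 0 such that u(t) is a strong solution … on [T*,∞)» (Leray's eventual regularity) —
`Step_eventual120`; Theorems 3–5 ((23), (29), (34): Oliver–Titi Gevrey-class product estimates) with
the sentence p.121 «This theorem demonstrates that the blow-up time is infinite so that the solution is
existent»; the Gevrey-norm differential inequalities (26)–(38); then (39) p.123, a differential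
inequality for the area `W(t)` of minimal 2-spheres under RICCI FLOW («∂ₜW(t) ≤ −4π − ½R_min(t)W(t)»,
from Tao's exposition of Perelman [3]) with «It demonstrates that the change of infimum of energy becomes
negative in finite [time] which is absurd. Therefore this forces blow-up in finite time. This means that
the solution blows up in a finite time, which is why the surgery approach will be used» —
`Step_blowup39`; and the decisive sentence p.123 «So the solution must blow up in some definite [time]
and the equation must hold even for τ as a solution. This proves that the solution is existent and
smooth.» — `Step_smooth123`; followed by decay bounds (41)–(51), the NS-minus-heat difference
(52)–(59) («as τ → ∞ the distance between heat equation solution and Navier-Stokes equation demonstrates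
convergence … then the solution for Navier-Stokes equations exist», p.125), the heat-ball mean-value
formula (60)–(67) and p.126 «So that λ → ∞ demonstrates that equation is existent … The previous
assumptions and results prove the existence of smooth and strong Navier-Stokes solution of equation in
R³»; Conclusion p.126: «If a surgery procedure is applied, the solution exists for some time, then blows
up, then arises again and that process repeats. This statement proves that the solution is either
existent or periodic, but it exists all the time.»

ORDER OF RECORD (print order; QUICK grain — the two sentences that carry the conclusion are typed, the
imported classical material is context):
* Step 1 = `Step_blowup39` — (39) and the two sentences after it, p.123 (PDF p.7): «this forces blow-up
  in finite time. This means that the solution blows up in a finite time». Typed at the claimed class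
  (the running «solution» is the solution of (1)–(3) from the data of the claimed statement): for every
  `ν > 0` and every Clay datum, the unforced Cauchy problem has NO global smooth bounded-energy solution.
  Charitable companion `Step_blowup39some` («the solution» = some solution): for every `ν > 0` SOME Clay
  datum has none (= unforced breakdown at every `ν`).
* Step 2 = `Step_smooth123` — p.123 (PDF p.7): «So the solution must blow up in some definite [time]
  and the equation must hold even for τ as a solution. This proves that the solution is existent and
  smooth.» Typed as the printed implication `Step_blowup39 → ClaimedTheorem`; companion
  `Step_smooth123some : Step_blowup39some → ClaimedTheorem`.
* Context (typed, not consumed): `Step_eventual120` — p.120 (PDF p.4), Leray's eventual regularity for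
  Leray–Hopf solutions (TRUE classical mathematics, Leray 1934 §34; stated with an a.e. modification).
  The Oliver–Titi / Okabe theorems (14), (22), (23), (29), (34) are quoted published results about OTHER
  objects' norms and are not typed; (39) is a statement about Ricci flow, not about (1)–(3), and enters
  only through the sentence typed as Step 1.

COMPOSITION — PROVED, every step consumed: `claim_of_steps : Step_blowup39 → Step_smooth123 →
ClaimedTheorem` and `claim_of_steps_some` (charitable pair). LOGIC RECORDS (pure logic + the tree's Δ7
scaling `clayR3_regularityAt_iff`; nothing of the paper asserted): `step_smooth123_of_not_blowup39` — if
Step 1 is false, Step 2 holds VACUOUSLY (the chain then carries no content); `step_smooth123some_iff_claim`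
— under the charitable reading Step 2 is EQUIVALENT to the claimed statement itself (ROUTE-5b shape:
«breakdown ⇒ regularity» ⟺ regularity, because «no unforced breakdown at some ν» is regularity at that
ν, which is (A) by scaling).

Kernel handles for the refuter (no verdict here): `Step_blowup39` is contradicted by the rest state
(zero datum, zero solution: tree `isNavierStokesSolution_zero`, `Literature.Claims.NS.Zhirkin2016.clayR3_solvable_zero`);
`Step_blowup39some` is Fefferman's (C) without forcing at every `ν` (open); `Step_smooth123some` ⟺ (A).

WHAT THIS IS NOT: not a claim about NS regularity or blow-up; not a claim about any author beyond the
typed locator.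
-/

open scoped ContDiff
open _root_.MeasureTheory _root_.Set Function

namespace Literature.Claims.NS.Vukovic2015

open Literature.Analysis.FluidPDE

noncomputable section

/-- Physical space `ℝ³`. [cite: Vukovic2015NSR3, §1 (1) p.117] -/
abbrev E3 : Type := EuclideanSpace ℝ (Fin 3)

/-! ## The claimed statement -/

/-- **The claimed statement, print p.118** («Take v > 0 and n = 3. Let u₀(x) be any smooth,
divergence-free vector field satisfying (1.4). Take f(x,t) to be identically zero. Then there exist
smooth functions p(x,t), uᵢ(x,t) on R³ x [0,∞] and the above conditions and equations are satisfied»,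
conditions (1)–(3), (6), (7) of p.117–118 = Fefferman's): for every `ν > 0` and every smooth
divergence-free rapidly decaying datum there are `u, p` smooth on `ℝ³ × [0,∞)` solving the unforced
system with datum `u₀` and bounded energy. Definitionally Fefferman's (A) (`claimedTheorem_iff_clayA`).
[claim: Vukovic2015NSR3, status: disputed] -/
def ClaimedTheorem : Prop :=
  ∀ ν : ℝ, 0 < ν → ∀ u₀ : E3 → E3, ContDiff ℝ ∞ u₀ → NSWave0.IsDivFree u₀ → HasRapidSpatialDecay u₀ →
    ∃ (u : ℝ → E3 → E3) (p : ℝ → E3 → ℝ),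
      IsSmoothOnHalfSpace u ∧ IsSmoothOnHalfSpace p ∧ IsNavierStokesSolution ν 0 u₀ u p ∧
        HasBoundedEnergy u

/-- The typed claim is Fefferman's (A), by `rfl`. [cite: FeffermanClay2006, (A) p. 2] -/
theorem claimedTheorem_iff_clayA : ClaimedTheorem ↔ ClayVariants.clayR3.Regularity :=
  Iff.rfl

/-- **Clay link** (trivial: no delta). [cite: FeffermanClay2006, (A) p. 2] -/
theorem clay_of_claimed (h : ClaimedTheorem) : ClayVariants.clayR3.Regularity :=
  h

/-! ## The steps -/

/-- **Context step — p.120 (PDF p.4)**: «turbulent solutions of Navier-Stokes equation become strong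
solutions after some definite time. So for the turbulent solution u(t) … there exists T* > 0 such that
u(t) is a strong solution of Navier-Stokes equation on [T*,∞)» (the paper's Def. 1 = Leray–Hopf weak
solutions with the strong energy inequality (13); here the tree's strict-sense `IsLerayHopfOn` on every
horizon; conclusion with an a.e.-in-space modification `v` of `u`). Leray's eventual-regularity theorem;
not consumed by the printed inference typed below. [claim: Vukovic2015NSR3, status: disputed] -/
def Step_eventual120 : Prop :=
  ∀ ν : ℝ, 0 < ν → ∀ (u₀ : E3 → E3) (u : ℝ → E3 → E3),
    (∀ T : ℝ, 0 < T → IsLerayHopfOn T ν 0 u₀ u) →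
      ∃ (Tstar : ℝ) (v : ℝ → E3 → E3) (p : ℝ → E3 → ℝ), 0 ≤ Tstar ∧
        IsClassicalNSSolutionOn (Ioi Tstar) ν 0 v p ∧ ∀ t ∈ Ioi Tstar, v t =ᵐ[volume] u t

/-- **Step 1 — (39) and the sentences after it, p.123 (PDF p.7)**: «The differential inequality is
obtained using structure of minimal surfaces and the Gauss-Bonnet formula [3]: ∂ₜW(t) ≤ −4π −
½R_min(t)W(t) … It demonstrates that the change of infimum of energy becomes negative in finite [time]
which is absurd. Therefore this forces blow-up in finite time. This means that the solution blows up in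
a finite time». Typed for «the solution» of the claimed statement's Cauchy problem (every `ν > 0`, every
Clay datum, `f ≡ 0`): it has NO global smooth bounded-energy solution.
[claim: Vukovic2015NSR3, status: disputed] -/
def Step_blowup39 : Prop :=
  ∀ ν : ℝ, 0 < ν → ∀ u₀ : E3 → E3, ContDiff ℝ ∞ u₀ → NSWave0.IsDivFree u₀ → HasRapidSpatialDecay u₀ →
    ¬ ClayVariants.clayR3.Solvable ν 0 u₀

/-- **Step 1, charitable companion** («the solution blows up» read as: SOME solution does): for every
`ν > 0` some Clay datum has no global smooth bounded-energy unforced solution (Fefferman's (C) without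
forcing, at every `ν`). [claim: Vukovic2015NSR3, status: disputed] -/
def Step_blowup39some : Prop :=
  ∀ ν : ℝ, 0 < ν → ∃ u₀ : E3 → E3, ContDiff ℝ ∞ u₀ ∧ NSWave0.IsDivFree u₀ ∧ HasRapidSpatialDecay u₀ ∧
    ¬ ClayVariants.clayR3.Solvable ν 0 u₀

/-- **Step 2 — p.123 (PDF p.7), the decisive sentence**: «So the solution must blow up in some definite
[time] and the equation must hold even for τ as a solution. This proves that the solution is existent
and smooth.» — the printed implication from Step 1 to the claimed statement.
[claim: Vukovic2015NSR3, status: disputed] -/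
def Step_smooth123 : Prop :=
  Step_blowup39 → ClaimedTheorem

/-- **Step 2, charitable companion**: the same implication from the charitable Step 1.
[claim: Vukovic2015NSR3, status: disputed] -/
def Step_smooth123some : Prop :=
  Step_blowup39some → ClaimedTheorem

/-! ## Kernel-checked relations (pure logic; nothing of the paper is asserted) -/

/-- **COMPOSITION** (p.123) — PROVED, every step consumed. [cite: Vukovic2015NSR3, p.123] -/
theorem claim_of_steps (h1 : Step_blowup39) (h2 : Step_smooth123) : ClaimedTheorem :=
  h2 h1

/-- **COMPOSITION, charitable pair** — PROVED. [cite: Vukovic2015NSR3, p.123] -/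
theorem claim_of_steps_some (h1 : Step_blowup39some) (h2 : Step_smooth123some) : ClaimedTheorem :=
  h2 h1

/-- **LOGIC RECORD (vacuity)**: if Step 1 fails, Step 2 holds vacuously — the chain `claim_of_steps`
then transmits nothing. [cite: Vukovic2015NSR3, p.123] -/
theorem step_smooth123_of_not_blowup39 (h : ¬ Step_blowup39) : Step_smooth123 :=
  fun h1 => absurd h1 h

/-- **LOGIC RECORD (ROUTE-5b shape)**: under the charitable reading, Step 2 («blow-up ⇒ existent and
smooth») is EQUIVALENT to the claimed statement: if no Clay datum breaks down at some `ν > 0` then (A)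
holds at that `ν`, hence at all `ν` by the Navier–Stokes scaling (`clayR3_regularityAt_iff`).
[cite: Vukovic2015NSR3, p.123] [cite: FeffermanClay2006, (A) (C) p. 2] -/
theorem step_smooth123some_iff_claim : Step_smooth123some ↔ ClaimedTheorem := by
  constructor
  · intro h
    by_cases hb : Step_blowup39some
    · exact h hb
    · -- some `ν > 0` at which every Clay datum is solvable: regularity at `ν`, hence (A)
      simp only [Step_blowup39some, not_forall, not_exists, not_and, not_not] at hb
      obtain ⟨ν, hν, hall⟩ := hb
      have hreg : ClayVariants.clayR3.RegularityAt ν := fun u₀ hu₀ hdiv hdec =>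
        hall u₀ hu₀ hdiv hdec
      exact (claimedTheorem_iff_clayA).2 ((ClayVariants.clayR3_regularityAt_iff hν).1 hreg)
  · exact fun h _ => h

/-! ## D-0026 in-file discharge of the context step (APPEND-ONLY; ns-claims debt pass, typist-7 g6,
2026-08-27)

Leray's eventual-regularity theorem (Leray 1934, §34; Robinson–Rodrigo–Sadowski 2016, Thm. 8.1) is a
tree theorem since `Literature/Analysis/FluidPDE/LerayHopfEventualRegularity.lean`
(`Literature.Analysis.FluidPDE.exists_classical_Ioi_of_isGlobalLerayHopf`: Leray's rate argument —
an `H¹`-escape time `β` of a Leray–Hopf solution satisfies `β ≤ K(u₀)²/(c ν⁵)`, then the proved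
Ladyzhenskaya–Prodi–Serrin representation and gluing over horizons `T_n ↑ ∞`). Hence the context
step `Step_eventual120` HOLDS exactly as typed. It is not consumed by `claim_of_steps`; the row's
verdict (C57 #66: false lemma @ `Step_blowup39`, (39) p.123) and every statement above are untouched. -/

/-- **The context step p.120 (PDF p.4) HOLDS — Leray's eventual regularity**: for every `ν > 0`
and every `u` that is Leray–Hopf (strict sense) on `ℝ³ × [0, T)` from `u₀` for all `T > 0`, there
are `T* ≥ 0` and a classical solution `(v, p)` on the time set `(T*, ∞)` with `v(t) = u(t)` a.e.
for every `t > T*` («turbulent solutions … become strong solutions after some definite time»).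
Kernel: `Literature.Analysis.FluidPDE.exists_classical_Ioi_of_isGlobalLerayHopf` (Leray 1934 §34 /
RRS 2016 Thm. 8.1, PROVED in the tree). [cite: Vukovic2015NSR3, p.120 (PDF p.4)] -/
theorem step_eventual120_holds : Step_eventual120 := by
  intro ν hν u₀ u hLH
  exact exists_classical_Ioi_of_isGlobalLerayHopf hν hLH

/-- `Step_eventual120` — `_holds` alias of `step_eventual120_holds` above under the fact's exact name (appended
2026-08-28, D-0026 bookkeeping: the proof term is the existing theorem of this file; no statement,
definition or attribute is edited; no new named fact; the ledger's debt table listed the fact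
unproved). [cite: Vukovic2015NSR3, p.120 (PDF p.4)] -/
theorem _root_.Literature.Claims.NS.Vukovic2015.Step_eventual120_holds : Step_eventual120 :=
  _root_.Literature.Claims.NS.Vukovic2015.step_eventual120_holds

end

end Literature.Claims.NS.Vukovic2015
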